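import Summits.ABC.ABC.Theorems.SomeWindowSaving.Negative.WindowFinite
import Summits.ABC.ABC.Theorems.SomeWindowSaving.Negative.TwistFamilyWindow
import Literature.Barriers.ABC.EpsilonCannotBeDroppedHolds

/-!
# Counting prime pairs `(p, d)` in the crux's windows

Negative-side support (cdisprove of stmt-ABC-1976): injectivity of `(p, d) ↦ twistFamily p d` on
index sets (with and without the size condition `d > 4p²`), the interval prime count `#primes(m, n] = π(n) − π(m)`, the lower-edge
inequality from a corner condition, the pair count
`#primes(m₁,n₁] · (#primes(m₂,n₂] − E) ≤ T⁺_[κ,σ](X)` (`card_pairs_le_windowCount'`, at most `E`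
bad twisting primes per `p`), and the prime supply
`π(y) − π(y/8) ≥ y/(8 log y)` for large `y` from the tree's PNT bounds.
-/

noncomputable section

open UniqueFactorizationMonoid IsDedekindDomain Real WeierstrassCurve Rat.HeightOneSpectrum
open Literature.NumberTheory.EllipticCurves

namespace Summit.ABC.ABC.Theorems.SomeWindowSaving.Negative

section TwistCounting

/-- **Injectivity of the twisted family without any size condition.**  On pairs of primes
`p ≥ 5`, `d` (any), `(p, d) ↦ twistFamily p d` is injective: from `Δ = 16 d⁶ M²`,
`c₄ = 16 d² (M + 1)` (`M = 4p²(4p²−1)`), two twisting primes `d ≠ d'` would give `d³ ∣ M'`,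
`d'³ ∣ M`, `M' = d³u`, `M = d'³u` and then `d² d'² u = d + d'`, impossible.  (Membership still needs `d ∤ M`; the count below excludes the
`O(1)` bad twisting primes per `p`.) -/
theorem injOn_twistFamily' {P D : Finset ℕ} (hP : ∀ p ∈ P, p.Prime ∧ 5 ≤ p)
    (hD : ∀ d ∈ D, d.Prime) :
    Set.InjOn (fun x : ℕ × ℕ ↦ twistFamily x.1 x.2) ((P ×ˢ D : Finset (ℕ × ℕ)) : Set (ℕ × ℕ)) := by
  rintro ⟨p, d⟩ hx ⟨p', d'⟩ hx' h
  simp only [Finset.coe_product, Set.mem_prod, Finset.mem_coe] at hx hx'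
  obtain ⟨hpP, hdD⟩ := hx
  obtain ⟨hpP', hdD'⟩ := hx'
  obtain ⟨hp, h5⟩ := hP p hpP
  obtain ⟨hp', h5'⟩ := hP p' hpP'
  have hd := hD d hdD
  have hd' := hD d' hdD'
  have hp3 := not_three_dvd_of_prime hp h5
  have hp3' := not_three_dvd_of_prime hp' h5'
  have hk := one_le_kOf hp3 hp.one_le
  have hk' := one_le_kOf hp3' hp'.one_le
  have hc : (twistFamily p d).c₄ = (twistFamily p' d').c₄ := by simp only at h; rw [h]
  have hΔ : (twistFamily p d).Δ = (twistFamily p' d').Δ := by simp only at h; rw [h]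
  rw [twistFamily_c₄, twistFamily_c₄] at hc
  rw [twistFamily_Δ, twistFamily_Δ] at hΔ
  set M := (1 : ℤ) * (3 * kOf p) * (1 + 3 * kOf p) with hM
  set M' := (1 : ℤ) * (3 * kOf p') * (1 + 3 * kOf p') with hM'
  have hM0 : 0 < M := by rw [hM]; positivity
  have hM0' : 0 < M' := by rw [hM']; positivity
  have hd0 : (0 : ℤ) < d := by exact_mod_cast hd.pos
  have hd0' : (0 : ℤ) < d' := by exact_mod_cast hd'.pos
  have hd2 : (2 : ℤ) ≤ d := by exact_mod_cast hd.two_le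
  have hd2' : (2 : ℤ) ≤ d' := by exact_mod_cast hd'.two_le
  -- the two covariant identities
  have hQ : (d : ℤ) ^ 2 * (M + 1) = (d' : ℤ) ^ 2 * (M' + 1) := by
    have e1 : (16 : ℤ) * (d : ℤ) ^ 2 * (1 ^ 2 + 1 * (3 * kOf p) + (3 * kOf p) ^ 2) =
        16 * ((d : ℤ) ^ 2 * (M + 1)) := by rw [hM]; ring
    have e2 : (16 : ℤ) * (d' : ℤ) ^ 2 * (1 ^ 2 + 1 * (3 * kOf p') + (3 * kOf p') ^ 2) =
        16 * ((d' : ℤ) ^ 2 * (M' + 1)) := by rw [hM']; ring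
    rw [e1, e2] at hc
    exact mul_left_cancel₀ (by norm_num) hc
  have h3 : (d : ℤ) ^ 3 * M = (d' : ℤ) ^ 3 * M' := by
    have h3 : ((d : ℤ) ^ 3 * M) ^ 2 = ((d' : ℤ) ^ 3 * M') ^ 2 := by
      have : (16 : ℤ) * ((d : ℤ) ^ 3 * M) ^ 2 = 16 * ((d' : ℤ) ^ 3 * M') ^ 2 := by
        rw [show (16 : ℤ) * ((d : ℤ) ^ 3 * M) ^ 2 = 16 * (d : ℤ) ^ 6 * M ^ 2 by ring,
          show (16 : ℤ) * ((d' : ℤ) ^ 3 * M') ^ 2 = 16 * (d' : ℤ) ^ 6 * M' ^ 2 by ring]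
        exact hΔ
      exact mul_left_cancel₀ (by norm_num) this
    exact (pow_left_inj₀ (by positivity) (by positivity) two_ne_zero).mp h3
  -- Step 1: `d = d'`.
  have hdd : d = d' := by
    by_contra hne
    have hcop : IsCoprime ((d : ℤ) ^ 3) ((d' : ℤ) ^ 3) := by
      have h : Nat.Coprime d d' := (Nat.coprime_primes hd hd').mpr hne
      exact IsCoprime.pow (Nat.isCoprime_iff_coprime.mpr h)
    have hdvd : (d : ℤ) ^ 3 ∣ M' * (d' : ℤ) ^ 3 := ⟨M, by linear_combination -h3⟩
    obtain ⟨u, hu⟩ : (d : ℤ) ^ 3 ∣ M' := hcop.dvd_of_dvd_mul_right hdvd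
    have hdvd' : (d' : ℤ) ^ 3 ∣ M * (d : ℤ) ^ 3 := ⟨M', by linear_combination h3⟩
    obtain ⟨v, hv⟩ : (d' : ℤ) ^ 3 ∣ M := hcop.symm.dvd_of_dvd_mul_right hdvd'
    -- `u = v`
    have huv : u = v := by
      rw [hu, hv] at h3
      have : (d : ℤ) ^ 3 * (d' : ℤ) ^ 3 * v = (d : ℤ) ^ 3 * (d' : ℤ) ^ 3 * u := by linear_combination h3
      exact (mul_left_cancel₀ (by positivity) this).symm
    subst huv
    have hu0 : 0 < u := by
      rw [hu] at hM0'
      exact pos_of_mul_pos_right hM0' (by positivity)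
    -- from `hQ`: `d² d'² u (d' − d) = (d' − d)(d' + d)`, cancel `d' − d ≠ 0`
    have hne' : (d' : ℤ) - d ≠ 0 := by
      intro h0
      have : (d' : ℤ) = d := by linarith
      exact hne (by exact_mod_cast this.symm)
    have hkey : (d : ℤ) ^ 2 * (d' : ℤ) ^ 2 * u = d + d' := by
      rw [hu, hv] at hQ
      have : ((d' : ℤ) - d) * ((d : ℤ) ^ 2 * (d' : ℤ) ^ 2 * u) = ((d' : ℤ) - d) * (d + d') := by
        linear_combination hQ
      exact mul_left_cancel₀ hne' this
    have h1 : (d : ℤ) + d' ≤ (d : ℤ) * d' := by nlinarith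
    have hu1 : (1 : ℤ) ≤ u := hu0
    have hdd0 : (0 : ℤ) < (d : ℤ) * d' := by positivity
    have h4 : (4 : ℤ) ≤ (d : ℤ) * d' * u := by nlinarith
    have h2 : (d : ℤ) * d' < (d : ℤ) ^ 2 * (d' : ℤ) ^ 2 * u := by
      have e : (d : ℤ) ^ 2 * (d' : ℤ) ^ 2 * u = ((d : ℤ) * d') * ((d : ℤ) * d' * u) := by ring
      rw [e]
      have : (d : ℤ) * d' * 1 < ((d : ℤ) * d') * ((d : ℤ) * d' * u) :=
        mul_lt_mul_of_pos_left (by linarith) hdd0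
      linarith
    linarith
  subst hdd
  -- Step 2: `k = k'`, hence `p = p'`.
  have hQ' : (1 : ℤ) ^ 2 + 1 * (3 * kOf p) + (3 * kOf p) ^ 2 =
      1 ^ 2 + 1 * (3 * kOf p') + (3 * kOf p') ^ 2 := by
    have hd2 : (16 : ℤ) * (d : ℤ) ^ 2 ≠ 0 := by positivity
    exact mul_left_cancel₀ hd2 hc
  have hkk : kOf p = kOf p' := by
    by_contra hne
    rcases lt_or_gt_of_ne hne with hlt | hlt <;> nlinarith
  have h3k := three_mul_kOf hp3
  have h3k' := three_mul_kOf hp3'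
  have hsq : (p : ℤ) ^ 2 = (p' : ℤ) ^ 2 := by rw [hkk] at h3k; linarith
  have hpp : (p : ℤ) = p' := (pow_left_inj₀ (by positivity) (by positivity) two_ne_zero).mp hsq
  have : p = p' := by exact_mod_cast hpp
  subst this
  rfl

/-- Primes in `(m, n]`: `#((Ioc m n).filter Prime) = π(n) − π(m)` for `m ≤ n`. -/
theorem card_primes_Ioc {m n : ℕ} (hmn : m ≤ n) :
    ((Finset.Ioc m n).filter Nat.Prime).card = Nat.primeCounting n - Nat.primeCounting m := by
  rw [← Nat.primesLE_card_eq_primeCounting, ← Nat.primesLE_card_eq_primeCounting]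
  have hsub : Nat.primesLE m ⊆ Nat.primesLE n := by
    intro q hq
    rw [Nat.mem_primesLE] at hq ⊢
    exact ⟨hq.1.trans hmn, hq.2⟩
  rw [← Finset.card_sdiff_of_subset hsub]
  congr 1
  ext q
  simp only [Finset.mem_filter, Finset.mem_Ioc, Finset.mem_sdiff, Nat.mem_primesLE]
  constructor
  · rintro ⟨⟨h1, h2⟩, h3⟩
    exact ⟨⟨h2, h3⟩, fun h ↦ by omega⟩
  · rintro ⟨⟨h1, h2⟩, h3⟩
    refine ⟨⟨?_, h1⟩, h2⟩
    by_contra h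
    exact h3 ⟨by omega, h2⟩

/-- Lower-edge inequality from the corner condition: for `3 < κ < 4`, `m₁ + 1 ≤ p`, `d ≤ n₂` and
`n₂^{2κ−6} ≤ 2^{23−13κ} (m₁+1)^{12−3κ}`, one has `(2¹³ p³ d²)^κ ≤ 13824000 p¹² d⁶`. -/
theorem lower_edge_of_corner {κ : ℝ} (hκ3 : 3 < κ) (hκ4 : κ < 4) {p d m₁ n₂ : ℕ}
    (hp : m₁ + 1 ≤ p) (hd : d ≤ n₂) (hd0 : 0 < d)
    (hc : (n₂ : ℝ) ^ (2 * κ - 6) ≤ (2 : ℝ) ^ (23 - 13 * κ) * ((m₁ : ℝ) + 1) ^ (12 - 3 * κ)) :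
    ((2 : ℝ) ^ 13 * (p : ℝ) ^ 3 * (d : ℝ) ^ 2) ^ κ ≤ 13824000 * (p : ℝ) ^ 12 * (d : ℝ) ^ 6 := by
  have hp0 : 0 < p := by omega
  have hp' : (0 : ℝ) < p := by exact_mod_cast hp0
  have hd' : (0 : ℝ) < d := by exact_mod_cast hd0
  have hmp : (m₁ : ℝ) + 1 ≤ p := by exact_mod_cast hp
  have h1 : (d : ℝ) ^ (2 * κ - 6) ≤ (2 : ℝ) ^ (23 - 13 * κ) * (p : ℝ) ^ (12 - 3 * κ) := by
    calc (d : ℝ) ^ (2 * κ - 6) ≤ (n₂ : ℝ) ^ (2 * κ - 6) :=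
          Real.rpow_le_rpow hd'.le (by exact_mod_cast hd) (by linarith)
      _ ≤ (2 : ℝ) ^ (23 - 13 * κ) * ((m₁ : ℝ) + 1) ^ (12 - 3 * κ) := hc
      _ ≤ (2 : ℝ) ^ (23 - 13 * κ) * (p : ℝ) ^ (12 - 3 * κ) := by
          have hexp : (0 : ℝ) ≤ 12 - 3 * κ := by linarith
          have := Real.rpow_le_rpow (by positivity : (0 : ℝ) ≤ (m₁ : ℝ) + 1) hmp hexp
          gcongr
  have e1 : ((2 : ℝ) ^ 13 * (p : ℝ) ^ 3 * (d : ℝ) ^ 2) ^ κ =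
      (2 : ℝ) ^ (13 * κ) * (p : ℝ) ^ (3 * κ) * (d : ℝ) ^ (2 * κ) := by
    have a1 : ((2 : ℝ) ^ 13) ^ κ = (2 : ℝ) ^ (13 * κ) := by
      rw [show ((2 : ℝ) ^ 13 : ℝ) = (2 : ℝ) ^ (13 : ℝ) by norm_num, ← Real.rpow_mul (by norm_num)]
    have a2 : ((p : ℝ) ^ 3) ^ κ = (p : ℝ) ^ (3 * κ) := by
      rw [show ((p : ℝ) ^ 3 : ℝ) = (p : ℝ) ^ (3 : ℝ) by norm_num, ← Real.rpow_mul hp'.le]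
    have a3 : ((d : ℝ) ^ 2) ^ κ = (d : ℝ) ^ (2 * κ) := by
      rw [show ((d : ℝ) ^ 2 : ℝ) = (d : ℝ) ^ (2 : ℝ) by norm_num, ← Real.rpow_mul hd'.le]
    rw [Real.mul_rpow (by positivity) (by positivity), Real.mul_rpow (by positivity) (by positivity),
      a1, a2, a3]
  have e2 : (d : ℝ) ^ (2 * κ) = (d : ℝ) ^ (2 * κ - 6) * (d : ℝ) ^ (6 : ℝ) := by
    rw [← Real.rpow_add hd']; congr 1; ring
  have e3 : (2 : ℝ) ^ (13 * κ) * (2 : ℝ) ^ (23 - 13 * κ) = (2 : ℝ) ^ (23 : ℝ) := by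
    rw [← Real.rpow_add (by norm_num)]; congr 1; ring
  have e4 : (p : ℝ) ^ (3 * κ) * (p : ℝ) ^ (12 - 3 * κ) = (p : ℝ) ^ (12 : ℝ) := by
    rw [← Real.rpow_add hp']; congr 1; ring
  rw [e1, e2]
  calc (2 : ℝ) ^ (13 * κ) * (p : ℝ) ^ (3 * κ) * ((d : ℝ) ^ (2 * κ - 6) * (d : ℝ) ^ (6 : ℝ))
      ≤ (2 : ℝ) ^ (13 * κ) * (p : ℝ) ^ (3 * κ) *
          (((2 : ℝ) ^ (23 - 13 * κ) * (p : ℝ) ^ (12 - 3 * κ)) * (d : ℝ) ^ (6 : ℝ)) := by gcongr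
    _ = ((2 : ℝ) ^ (13 * κ) * (2 : ℝ) ^ (23 - 13 * κ)) * ((p : ℝ) ^ (3 * κ) * (p : ℝ) ^ (12 - 3 * κ)) *
          (d : ℝ) ^ (6 : ℝ) := by ring
    _ = (2 : ℝ) ^ (23 : ℝ) * (p : ℝ) ^ (12 : ℝ) * (d : ℝ) ^ (6 : ℝ) := by rw [e3, e4]
    _ = 2 ^ 23 * (p : ℝ) ^ 12 * (d : ℝ) ^ 6 := by norm_num
    _ ≤ 13824000 * (p : ℝ) ^ 12 * (d : ℝ) ^ 6 := by gcongr; norm_num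

/-- Few bad twisting primes: if every `d ∈ D` is a prime `≥ m₂ + 1 ≥ 2` and `0 < Mn < (m₂+1)^E`,
then fewer than `E` elements of `D` divide `Mn` (their product divides `Mn`). -/
theorem card_filter_dvd_lt {D : Finset ℕ} {m₂ E Mn : ℕ} (hD : ∀ d ∈ D, d.Prime ∧ m₂ + 1 ≤ d)
    (hMn : 0 < Mn) (hE : Mn < (m₂ + 1) ^ E) : (D.filter (· ∣ Mn)).card < E := by
  classical
  set B := D.filter (· ∣ Mn) with hB
  have hBmem : ∀ d ∈ B, (d.Prime ∧ m₂ + 1 ≤ d) ∧ d ∣ Mn := fun d hd ↦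
    ⟨hD d (Finset.mem_filter.mp hd).1, (Finset.mem_filter.mp hd).2⟩
  have hprod : ∏ d ∈ B, d ∣ Mn :=
    Finset.prod_primes_dvd Mn (fun d hd ↦ Nat.prime_iff.mp (hBmem d hd).1.1)
      (fun d hd ↦ (hBmem d hd).2)
  have hle : (m₂ + 1) ^ B.card ≤ ∏ d ∈ B, d :=
    Finset.pow_card_le_prod B (fun d ↦ d) (m₂ + 1) (fun d hd ↦ (hBmem d hd).1.2)
  have h : (m₂ + 1) ^ B.card < (m₂ + 1) ^ E :=
    lt_of_le_of_lt (hle.trans (Nat.le_of_dvd hMn hprod)) hE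
  by_contra hge
  rw [not_lt] at hge
  have : (m₂ + 1) ^ E ≤ (m₂ + 1) ^ B.card := Nat.pow_le_pow_right (by omega) hge
  omega

/-- **Pair counting with exclusions** (no size relation between `d` and `p`).  For
`3 < κ < 4 ≤ 12 < σ`: primes `p ∈ (m₁, n₁]`, `d ∈ (m₂, n₂]` with `p₁ ≤ m₁ + 1`, `4 ≤ m₂`,
`16 n₁⁴ < (m₂+1)^E` (so at most `E` twisting primes per `p` divide `4p²(4p²−1)`), the corner
condition and `X ≥ 2¹³ n₁³ n₂²` give `#primes(m₁,n₁] · (#primes(m₂,n₂] − E) ≤ T⁺_[κ,σ](X)`. -/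
theorem card_pairs_le_windowCount' {κ σ : ℝ} (hκ3 : 3 < κ) (hκ4 : κ < 4) (hσ : 12 < σ) :
    ∃ p₁ : ℕ, 5 ≤ p₁ ∧ ∀ (m₁ n₁ m₂ n₂ E : ℕ) (X : ℝ), p₁ ≤ m₁ + 1 → 4 ≤ m₂ →
      16 * n₁ ^ 4 < (m₂ + 1) ^ E →
      (n₂ : ℝ) ^ (2 * κ - 6) ≤ (2 : ℝ) ^ (23 - 13 * κ) * ((m₁ : ℝ) + 1) ^ (12 - 3 * κ) →
      (2 : ℝ) ^ 13 * (n₁ : ℝ) ^ 3 * (n₂ : ℝ) ^ 2 ≤ X →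
      ((Finset.Ioc m₁ n₁).filter Nat.Prime).card *
          (((Finset.Ioc m₂ n₂).filter Nat.Prime).card - E) ≤ windowCount κ σ X := by
  classical
  obtain ⟨p₁, h5, hmem⟩ := twistFamily_mem_windowSet' (by linarith : (0 : ℝ) < κ) hσ
  refine ⟨p₁, h5, fun m₁ n₁ m₂ n₂ E X hm₁ hm₂ hE hc hX ↦ ?_⟩
  set P := (Finset.Ioc m₁ n₁).filter Nat.Prime with hP
  set D := (Finset.Ioc m₂ n₂).filter Nat.Prime with hD
  have hPmem : ∀ p ∈ P, p.Prime ∧ m₁ + 1 ≤ p ∧ p ≤ n₁ := by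
    intro p hp
    simp only [hP, Finset.mem_filter, Finset.mem_Ioc] at hp
    exact ⟨hp.2, hp.1.1, hp.1.2⟩
  have hDmem : ∀ d ∈ D, d.Prime ∧ m₂ + 1 ≤ d ∧ d ≤ n₂ := by
    intro d hd
    simp only [hD, Finset.mem_filter, Finset.mem_Ioc] at hd
    exact ⟨hd.2, hd.1.1, hd.1.2⟩
  -- `Mn p = |AB(A+B)| = 4p²(4p²−1) ≤ 16 n₁⁴`
  set Mn : ℕ → ℕ := fun p ↦ ((1 : ℤ) * (3 * kOf p) * (1 + 3 * kOf p)).natAbs with hMn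
  have hMnP : ∀ p ∈ P, 0 < Mn p ∧ Mn p ≤ 16 * n₁ ^ 4 := by
    intro p hp
    obtain ⟨hpr, hpm, hpn⟩ := hPmem p hp
    have hp3 := not_three_dvd_of_prime hpr (h5.trans (hm₁.trans hpm))
    obtain ⟨hn, hK⟩ := natAbs_freyFamily_prod hp3 hpr.one_le
    refine ⟨Int.natAbs_pos.mpr (freyFamily_prod_ne_zero hp3 hpr.one_le), ?_⟩
    show ((1 : ℤ) * (3 * kOf p) * (1 + 3 * kOf p)).natAbs ≤ 16 * n₁ ^ 4
    rw [hn]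
    calc 3 * (kOf p).natAbs * (4 * p ^ 2) ≤ (4 * p ^ 2) * (4 * p ^ 2) := by
          apply Nat.mul_le_mul_right; omega
      _ = 16 * p ^ 4 := by ring
      _ ≤ 16 * n₁ ^ 4 := by gcongr
  set S := (P ×ˢ D).filter (fun x : ℕ × ℕ ↦ ¬ x.2 ∣ Mn x.1) with hS
  have hSsub : (S : Set (ℕ × ℕ)) ⊆ ((P ×ˢ D : Finset (ℕ × ℕ)) : Set (ℕ × ℕ)) :=
    Finset.coe_subset.mpr (Finset.filter_subset _ _)
  have hinj : Set.InjOn (fun x : ℕ × ℕ ↦ twistFamily x.1 x.2) (S : Set (ℕ × ℕ)) :=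
    (injOn_twistFamily' (fun p hp ↦ ⟨(hPmem p hp).1, h5.trans (hm₁.trans (hPmem p hp).2.1)⟩)
      (fun d hd ↦ (hDmem d hd).1)).mono hSsub
  have hsub : ((S.image fun x : ℕ × ℕ ↦ twistFamily x.1 x.2 : Finset (WeierstrassCurve ℤ)) :
      Set (WeierstrassCurve ℤ)) ⊆ windowSet κ σ X := by
    intro W hW
    rw [Finset.coe_image] at hW
    obtain ⟨⟨p, d⟩, hx, rfl⟩ := hW
    rw [Finset.mem_coe, hS, Finset.mem_filter, Finset.mem_product] at hx
    obtain ⟨⟨hpP, hdD⟩, hndvd⟩ := hx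
    obtain ⟨hp, hpm, hpn⟩ := hPmem p hpP
    obtain ⟨hd, hdm, hdn⟩ := hDmem d hdD
    have hdM : ¬ (d : ℤ) ∣ (1 : ℤ) * (3 * kOf p) * (1 + 3 * kOf p) :=
      fun h ↦ hndvd (Int.natCast_dvd.mp h)
    refine hmem p d hp hd (hm₁.trans hpm) (by omega) hdM
      (lower_edge_of_corner hκ3 hκ4 hpm hdn hd.pos hc) X (le_trans ?_ hX)
    have h1 : (p : ℝ) ≤ n₁ := by exact_mod_cast hpn
    have h2 : (d : ℝ) ≤ n₂ := by exact_mod_cast hdn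
    gcongr
  have hcardS : S.card ≤ windowCount κ σ X := by
    calc S.card = (S.image fun x : ℕ × ℕ ↦ twistFamily x.1 x.2).card :=
          (Finset.card_image_of_injOn hinj).symm
      _ = (((S.image fun x : ℕ × ℕ ↦ twistFamily x.1 x.2 : Finset (WeierstrassCurve ℤ)) :
            Set (WeierstrassCurve ℤ))).ncard := (Set.ncard_coe_finset _).symm
      _ ≤ windowCount κ σ X := Set.ncard_le_ncard hsub (windowSet_finite κ σ X)
  -- the bad pairs are few
  set Bad := (P ×ˢ D).filter (fun x : ℕ × ℕ ↦ x.2 ∣ Mn x.1) with hBad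
  have hsplit : Bad.card + S.card = (P ×ˢ D).card :=
    Finset.card_filter_add_card_filter_not (s := P ×ˢ D) (fun x : ℕ × ℕ ↦ x.2 ∣ Mn x.1)
  have hBadle : Bad.card ≤ P.card * E := by
    have hBadsub : Bad ⊆ P.biUnion (fun p ↦ (D.filter (· ∣ Mn p)).image (fun d ↦ (p, d))) := by
      rintro ⟨p, d⟩ hx
      rw [hBad, Finset.mem_filter, Finset.mem_product] at hx
      obtain ⟨⟨hpP, hdD⟩, hdiv⟩ := hx
      rw [Finset.mem_biUnion]
      exact ⟨p, hpP, Finset.mem_image.mpr ⟨d, Finset.mem_filter.mpr ⟨hdD, hdiv⟩, rfl⟩⟩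
    calc Bad.card ≤ (P.biUnion (fun p ↦ (D.filter (· ∣ Mn p)).image (fun d ↦ (p, d)))).card :=
          Finset.card_le_card hBadsub
      _ ≤ P.card * E := by
          refine Finset.card_biUnion_le_card_mul _ _ _ (fun p hp ↦ ?_)
          calc ((D.filter (· ∣ Mn p)).image (fun d ↦ (p, d))).card ≤ (D.filter (· ∣ Mn p)).card :=
                Finset.card_image_le
            _ ≤ E := (card_filter_dvd_lt (fun d hd ↦ ⟨(hDmem d hd).1, (hDmem d hd).2.1⟩)
                (hMnP p hp).1 ((hMnP p hp).2.trans_lt hE)).le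
  -- combine
  have hprodcard : (P ×ˢ D).card = P.card * D.card := Finset.card_product _ _
  have hfinal : P.card * (D.card - E) ≤ S.card := by
    rw [mul_tsub]
    generalize ha : P.card * D.card = a at *
    generalize hb : P.card * E = b at *
    omega
  exact hfinal.trans hcardS

/-- **Prime supply in `(y/8, y]`** from the prime number theorem bounds of the tree
(`StewartTijdeman.eventually_primeCounting_bounds`): `π(y) − π(y/8) ≥ y/(8 log y)` for large `y`. -/
theorem prime_supply : ∃ Y₀ : ℝ, 64 ≤ Y₀ ∧ ∀ y : ℝ, Y₀ ≤ y →
    y / (8 * Real.log y) ≤ (Nat.primeCounting ⌊y⌋₊ : ℝ) - Nat.primeCounting ⌊y / 8⌋₊ := by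
  have h := Literature.Barriers.ABC.StewartTijdeman.eventually_primeCounting_bounds
    (by norm_num : (0 : ℝ) < 1 / 2)
  obtain ⟨y₁, hy₁⟩ := Filter.eventually_atTop.mp h
  refine ⟨max (8 * max y₁ 1) 64, le_max_right _ _, fun y hy ↦ ?_⟩
  have hy64 : (64 : ℝ) ≤ y := (le_max_right _ _).trans hy
  have hy8 : max y₁ 1 ≤ y / 8 := by
    have := (le_max_left _ _).trans hy
    linarith
  have hyy₁ : y₁ ≤ y := by
    have h1 : y₁ ≤ max y₁ 1 := le_max_left _ _
    have h2 : (1 : ℝ) ≤ max y₁ 1 := le_max_right _ _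
    linarith
  obtain ⟨hlo, -⟩ := hy₁ y hyy₁
  obtain ⟨-, hhi⟩ := hy₁ (y / 8) ((le_max_left _ _).trans hy8)
  have hlogy : 0 < Real.log y := Real.log_pos (by linarith)
  have hlog8 : Real.log y / 2 ≤ Real.log (y / 8) := by
    rw [Real.log_div (by linarith) (by norm_num)]
    have : Real.log 64 ≤ Real.log y := Real.log_le_log (by norm_num) hy64
    have h64 : Real.log (64 : ℝ) = 2 * Real.log 8 := by
      rw [show (64 : ℝ) = 8 ^ 2 by norm_num, Real.log_pow]; norm_num
    linarith
  have hlog8pos : 0 < Real.log (y / 8) := by linarith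
  have h2 : y / 8 / Real.log (y / 8) ≤ y / 8 / (Real.log y / 2) :=
    div_le_div_of_nonneg_left (by linarith) (by linarith) hlog8
  have h3 : (Nat.primeCounting ⌊y / 8⌋₊ : ℝ) ≤ 3 * y / (8 * Real.log y) := by
    calc (Nat.primeCounting ⌊y / 8⌋₊ : ℝ) ≤ (1 + 1 / 2) * (y / 8 / Real.log (y / 8)) := hhi
      _ ≤ (1 + 1 / 2) * (y / 8 / (Real.log y / 2)) := by gcongr
      _ = 3 * y / (8 * Real.log y) := by field_simp; ring
  have h4 : (1 - 1 / 2) * (y / Real.log y) = y / (2 * Real.log y) := by field_simp; ring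
  rw [h4] at hlo
  have h5 : y / (8 * Real.log y) = y / (2 * Real.log y) - 3 * y / (8 * Real.log y) := by
    field_simp; ring
  rw [h5]
  linarith

end TwistCounting

end Summit.ABC.ABC.Theorems.SomeWindowSaving.Negative
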